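import Literature.MathematicalPhysics.QuantumLattice.HubbardOpenBoxVersusTorus
import Literature.MathematicalPhysics.QuantumLattice.HubbardTorus2DEnergyDensityConvex
import Mathlib.Analysis.Convex.Deriv
import HarnessLib

/-!
# Sector ground energies of the free-boundary Hubbard boxes versus the thermodynamic energy density

Topic `Literature/MathematicalPhysics/QuantumLattice`; namespace
`Literature.MathematicalPhysics.QuantumLattice.ThermodynamicLimit`. Companion of
`HubbardTorus2DEnergyDensity(Convex).lean` and `HubbardOpenBoxVersusTorus.lean`: the inputs of the
variational principle for the ground-state energy density of the 2D Hubbard model (`U ≥ 0`), namely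
lower bounds on ALL sector ground energies `E_{[0,ℓ)²}(N)` of the free-boundary boxes by an affine
minorant of the thermodynamic energy density `e = energyDensity2D t U`. Everything is PROVED; no
definition, no named fact.

## Results

* `groundEnergyAt_zero_eq`, `groundEnergyAt_one_le_zero`: `E_G(0) = 0`, `E_G(1) ≤ 0` (vacuum;
  a localised electron has energy `0`).
* `exists_bipartite_sign_polyGraph`: the induced graph of any finite `A ⊆ ℤ^d` is bipartite
  (parity of the coordinate sum); hence by particle–hole symmetry (`groundEnergyAt_particleHole`)
  `groundEnergyAt_polyGraph_full : E_A(2|A|) = U|A|` and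
  `groundEnergyAt_polyGraph_full_sub_one_le : E_A(2|A| - 1) ≤ U|A|` (`U ≥ 0`).
* `energyDensity2D_le_of_lt`: the tiling bound for ALL particle numbers `N < 2ℓ²` (any parity):
  `e(N/ℓ²) ≤ E_{ℓ×ℓ}(N)/ℓ² + 16|t|/ℓ` (tile a `2kℓ × 2kℓ` torus — even multiples, so no rounding).
* `sq_mul_energyDensity2D_le_groundEnergyAt_box`: `ℓ² e(N/ℓ²) ≤ E_{[0,ℓ)²}(N) + 48|t| ℓ` for
  `N < 2ℓ²` (with `groundEnergyAt_rect_le_polyGraph_halfOpenBox`).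
* `exists_supporting_line_energyDensity2D`: convexity gives, at every density `0 < ρ < 2`, a
  slope `s` with `e(ρ) + s (x - ρ) ≤ e(x)` on `[0,2)`; and `supporting_line_at_two_le`:
  `e(ρ) + s (2 - ρ) ≤ U` (the line stays below the box energies up to the filled band).
-/

noncomputable section

open Matrix Finset Filter
open scoped ComplexOrder BigOperators Topology

namespace Literature.MathematicalPhysics.QuantumLattice

open Literature.Probability.LatticeModels HubbardWave0

namespace ThermodynamicLimit

/-! ### The empty and the one-particle sector -/

section SmallSectors

variable {Λ : Type*} [LinearOrder Λ] [Fintype Λ] (G : SimpleGraph Λ) [DecidableRel G.Adj] (t U : ℝ)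

/-- **The vacuum sector has energy `0`**: `E_G(0) = 0` (the only unit `0`-particle vectors are
phases times `|∅⟩`, and `H |∅⟩ = 0`). [folklore] -/
theorem groundEnergyAt_zero_eq : groundEnergyAt G t U 0 = 0 := by
  have hset : {E : ℝ | ∃ ψ : Fock (Orb Λ), IsNParticle 0 ψ ∧ star ψ ⬝ᵥ ψ = 1 ∧ E = (expect (hamiltonian G t U) ψ).re} =
      {0} := by
    ext E
    simp only [Set.mem_setOf_eq, Set.mem_singleton_iff]
    constructor
    · rintro ⟨ψ, hψ, -, rfl⟩
      have hvac : ψ = ψ ∅ • (vacuum : Fock (Orb Λ)) := by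
        funext s
        rw [Pi.smul_apply, vacuum, Pi.single_apply, smul_eq_mul]
        by_cases hs : s = ∅
        · subst hs; rw [if_pos rfl, mul_one]
        · rw [if_neg hs, mul_zero, hψ s (fun h => hs (Finset.card_eq_zero.1 h))]
      rw [expect, hvac, mulVec_smul, hamiltonian_mulVec_vacuum, smul_zero, dotProduct_zero, Complex.zero_re]
    · rintro rfl
      refine ⟨vacuum, ?_, ?_, ?_⟩
      · intro s hs
        rw [vacuum, Pi.single_apply, if_neg]
        exact fun h => hs (by rw [h, Finset.card_empty])
      · rw [vacuum, dotProduct_single, Pi.star_apply, Pi.single_eq_same, star_one, one_mul]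
      · rw [expect, hamiltonian_mulVec_vacuum, dotProduct_zero, Complex.zero_re]
  rw [groundEnergyAt, groundEnergy, hset, csInf_singleton]

/-- `c_j |{i}⟩ = 0` for `j ≠ i`. [folklore] -/
theorem annihilation_mulVec_single_singleton_of_ne {ι : Type*} [LinearOrder ι] [Fintype ι] {i j : ι} (h : j ≠ i) :
    annihilation j *ᵥ Pi.single ({i} : Finset ι) (1 : ℂ) = 0 := by
  rw [annihilation_mulVec_single, if_neg]
  rwa [Finset.mem_singleton]

/-- **A localised electron has energy `0`**, so `E_G(1) ≤ 0` (on a nonempty lattice): the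
occupation basis vector `|{(x,↑)}⟩` is annihilated by every `c_j`, `j ≠ (x,↑)`, so all hopping
and interaction terms have zero expectation. [folklore] -/
theorem groundEnergyAt_one_le_zero [Nonempty Λ] : groundEnergyAt G t U 1 ≤ 0 := by
  obtain ⟨x⟩ := ‹Nonempty Λ›
  set i : Orb Λ := orb x 0 with hi
  set ψ : Fock (Orb Λ) := Pi.single ({i} : Finset (Orb Λ)) 1 with hψ
  have hN : IsNParticle 1 ψ := fun s hs => by
    rw [hψ, Pi.single_apply, if_neg]
    rintro rfl
    exact hs (Finset.card_singleton i)
  have h1 : star ψ ⬝ᵥ ψ = 1 := by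
    rw [hψ, dotProduct_single, Pi.star_apply, Pi.single_eq_same, star_one, one_mul]
  have hE := groundEnergy_le_re_expect (hamiltonian G t U) hN h1
  refine hE.trans (le_of_eq ?_)
  rw [expect, dotProduct_hamiltonian_mulVec, Complex.add_re]
  have hhop : ∀ (a b : Λ) (σ : Fin 2), G.Adj a b →
      star (annihilation (orb a σ) *ᵥ ψ) ⬝ᵥ (annihilation (orb b σ) *ᵥ ψ) = 0 := by
    intro a b σ hab
    have hne : a ≠ b := G.ne_of_adj hab
    by_cases ha : orb a σ = i
    · have hb : orb b σ ≠ i := by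
        rw [← ha]
        intro h
        exact hne (congrArg (fun o : Orb Λ => (ofLex o).1) h).symm
      rw [hψ, annihilation_mulVec_single_singleton_of_ne hb, dotProduct_zero]
    · rw [hψ, annihilation_mulVec_single_singleton_of_ne ha, star_zero, zero_dotProduct]
  have hint : ∀ a : Λ, star ψ ⬝ᵥ (numberOp a 0 *ᵥ (numberOp a 1 *ᵥ ψ)) = 0 := by
    intro a
    have h1' : orb a 1 ≠ i := by
      rw [hi]
      intro h
      have h2 := congrArg (fun o : Orb Λ => (ofLex o).2) h
      simp [orb] at h2
    have hn1 : numberOp a 1 *ᵥ ψ = 0 := by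
      rw [numberOp, ← mulVec_mulVec, hψ, annihilation_mulVec_single_singleton_of_ne h1', mulVec_zero]
    rw [hn1, mulVec_zero, dotProduct_zero]
  rw [Finset.sum_eq_zero (fun a _ => Finset.sum_eq_zero fun b _ => Finset.sum_eq_zero fun σ _ => by
      split_ifs with hab
      · exact hhop a b σ hab
      · rfl),
    Finset.sum_eq_zero (fun a _ => hint a)]
  simp

end SmallSectors

/-! ### The boxes of `ℤ^d` are bipartite; the filled and the almost filled sector -/

section Bipartite

variable {d : ℕ}

/-- **The induced nearest-neighbour graph of a finite `A ⊆ ℤ^d` is bipartite**: the parity of the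
coordinate sum is a bipartite sign. [folklore] -/
theorem exists_bipartite_sign_polyGraph (A : Finset (Site d)) :
    ∃ ε : PolySite A → ℤˣ, ∀ x y, (polyGraph A).Adj x y → ε x = -ε y := by
  refine ⟨fun x => if Even (∑ i, ofLex x.1 i) then 1 else -1, fun x y hxy => ?_⟩
  rw [polyGraph_adj, zdGraph_adj_iff] at hxy
  have key : ∀ {a b : Site d} (i : Fin d), b = a + Pi.single i 1 → (∑ j, b j) = (∑ j, a j) + 1 := by
    intro a b i h
    rw [h]
    simp [Finset.sum_add_distrib]
  have flip : ∀ n : ℤ, (if Even (n + 1) then (1 : ℤˣ) else -1) = -(if Even n then 1 else -1) := by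
    intro n
    by_cases hn : Even n
    · simp [hn]
    · simp [hn]
  dsimp only
  obtain ⟨i, h | h⟩ := hxy
  · rw [key i h, flip, neg_neg]
  · rw [key i h, flip]

/-- `|PolySite A| = |A|`. [folklore] -/
theorem card_polySite (A : Finset (Site d)) : Fintype.card (PolySite A) = A.card := by
  unfold PolySite lexSites
  rw [Fintype.card_coe, Finset.card_map]

variable (t : ℝ) {U : ℝ}

/-- **The filled band**: `E_A(2|A|) = U |A|` (particle–hole symmetry: `E(2|A|) = E(0) + U|A|`).
[cite: LiebPRL1989, proof of Theorem 1] -/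
theorem groundEnergyAt_polyGraph_full (U : ℝ) (A : Finset (Site d)) :
    groundEnergyAt (polyGraph A) t U (2 * Fintype.card (PolySite A)) = U * Fintype.card (PolySite A) := by
  obtain ⟨ε, hε⟩ := exists_bipartite_sign_polyGraph A
  have h := groundEnergyAt_particleHole (polyGraph A) ε hε t U (N := 0) (Nat.zero_le _)
  rw [groundEnergyAt_zero_eq, Nat.sub_zero] at h
  push_cast at h
  linarith

/-- **One hole in the filled band**: `E_A(2|A| - 1) ≤ U |A|` for `U ≥ 0`
(`E(2|A| - 1) = E(1) + U(|A| - 1)` and `E(1) ≤ 0`). [cite: LiebPRL1989, proof of Theorem 1] -/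
theorem groundEnergyAt_polyGraph_full_sub_one_le (hU : 0 ≤ U) (A : Finset (Site d)) (hA : A.Nonempty) :
    groundEnergyAt (polyGraph A) t U (2 * Fintype.card (PolySite A) - 1) ≤ U * Fintype.card (PolySite A) := by
  obtain ⟨ε, hε⟩ := exists_bipartite_sign_polyGraph A
  haveI : Nonempty (PolySite A) := by
    obtain ⟨x, hx⟩ := hA
    exact ⟨PolySite.pt x hx⟩
  have hcard : 1 ≤ Fintype.card (PolySite A) := Fintype.card_pos
  have h := groundEnergyAt_particleHole (polyGraph A) ε hε t U (N := 1) (by omega)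
  have h1 := groundEnergyAt_one_le_zero (polyGraph A) t U
  have hc : ((Fintype.card (PolySite A) : ℝ) - (1 : ℕ)) * U ≤ U * Fintype.card (PolySite A) := by
    push_cast; nlinarith
  push_cast at h
  linarith

end Bipartite

/-! ### The tiling bound for all particle numbers -/

/-- **Tiling bound, any parity**: for `U ≥ 0`, `ℓ ≥ 1` and every `N < 2ℓ²`,
`e(N/ℓ²) ≤ E_{ℓ×ℓ}(N)/ℓ² + 16|t|/ℓ` — tile the `2kℓ × 2kℓ` torus by `(2k)²` copies of the `ℓ × ℓ`
torus each carrying `N` particles (`(2k)² N = N_{2kℓ}(N/ℓ²)` exactly, no rounding) and let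
`k → ∞`. [cite: Ruelle1969, §3.3] -/
theorem energyDensity2D_le_of_lt (t : ℝ) {U : ℝ} (hU : 0 ≤ U) {ℓ : ℕ} (hℓ : 1 ≤ ℓ) {N : ℕ} (hN : N < 2 * (ℓ * ℓ)) :
    energyDensity2D t U ((N : ℝ) / (ℓ : ℝ) ^ 2) ≤
      groundEnergyAt (fermionRectTorusGraph ℓ ℓ) t U N / (ℓ : ℝ) ^ 2 + 16 * |t| / ℓ := by
  set n : ℝ := (N : ℝ) / (ℓ : ℝ) ^ 2 with hn
  have hℓpos : (0 : ℝ) < ℓ := by exact_mod_cast hℓ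
  have hℓ2 : (0 : ℝ) < (ℓ : ℝ) ^ 2 := by positivity
  have hn0 : 0 ≤ n := by positivity
  have hn2 : n < 2 := by
    rw [hn, div_lt_iff₀ hℓ2]
    have : (N : ℝ) < 2 * (ℓ * ℓ : ℕ) := by exact_mod_cast hN
    push_cast at this; nlinarith
  -- the subsequence `L_m = 2(m+1) ℓ`
  set K : ℕ → ℕ := fun m => 2 * (m + 1) with hK
  have hrect : ∀ m, rectN n (K m * ℓ) = K m ^ 2 * N := by
    intro m
    rw [rectN]
    have : n * ((K m * ℓ : ℕ) : ℝ) ^ 2 / 2 = ((2 * N * (m + 1) ^ 2 : ℕ) : ℝ) := by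
      rw [hn, hK]; push_cast; field_simp
    rw [this, Nat.floor_natCast, hK]; ring
  have htile : ∀ m, groundEnergyAt (fermionRectTorusGraph (K m * ℓ) (K m * ℓ)) t U (rectN n (K m * ℓ)) ≤
      (K m : ℝ) ^ 2 * groundEnergyAt (fermionRectTorusGraph ℓ ℓ) t U N + 16 * |t| * ℓ * (K m) ^ 2 := by
    intro m
    have h := groundEnergyAt_square_tiling ℓ t U (2 * m + 1) (fun _ _ => N) (fun _ _ => hN.le)
    have hKm : 2 * m + 1 + 1 = K m := by simp only [hK]; ring
    simp only [sum_const, card_univ, Fintype.card_fin, smul_eq_mul, nsmul_eq_mul] at h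
    rw [hKm] at h
    have hmul : K m * (K m * N) = K m ^ 2 * N := by ring
    rw [hmul] at h
    rw [hrect m]
    push_cast at h
    have hKr : ((K m : ℕ) : ℝ) = 2 * (m : ℝ) + 2 := by simp only [hK]; push_cast; ring
    rw [hKr] at h ⊢
    have hextra : 0 ≤ 16 * |t| * (ℓ : ℝ) * (2 * m + 2) := by positivity
    have hid : (2 * (m : ℝ) + 2) ^ 2 * groundEnergyAt (fermionRectTorusGraph ℓ ℓ) t U N +
        16 * |t| * ℓ * (2 * (m : ℝ) + 2) ^ 2 =
        (2 * (m : ℝ) + 2) * ((2 * (m : ℝ) + 2) * groundEnergyAt (fermionRectTorusGraph ℓ ℓ) t U N) +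
          16 * |t| * ℓ * (2 * m + 1) * (2 * m + 1 + 1) + 16 * |t| * ℓ * (2 * m + 2) := by ring
    rw [hid]
    linarith
  -- divide by `L_m²` and pass to the limit along the subsequence
  have hlim := (tendsto_energyDensity2D t hU hn0 hn2).comp
    (tendsto_atTop_mono (fun m => by show m ≤ K m * ℓ; rw [hK]; nlinarith) tendsto_id)
  refine le_of_tendsto hlim (Eventually.of_forall fun m => ?_)
  have hKpos : (0 : ℝ) < K m := by rw [hK]; positivity
  have hL2 : (0 : ℝ) < ((K m * ℓ : ℕ) : ℝ) ^ 2 := by positivity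
  rw [Function.comp_apply, div_le_iff₀ hL2]
  calc _ ≤ (K m : ℝ) ^ 2 * groundEnergyAt (fermionRectTorusGraph ℓ ℓ) t U N + 16 * |t| * ℓ * (K m) ^ 2 := htile m
    _ = _ := by push_cast; field_simp

/-- **The thermodynamic energy density minorises all box sectors** (up to a boundary term):
`ℓ² e(N/ℓ²) ≤ E_{[0,ℓ)²}(N) + 48|t| ℓ` for `U ≥ 0`, `ℓ ≥ 1`, `N < 2ℓ²`, the box energy being that of
the free-boundary Hubbard Hamiltonian `hamiltonian (polyGraph (halfOpenBox 2 ℓ)) t U`.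
[cite: Ruelle1969, §3.3] -/
theorem sq_mul_energyDensity2D_le_groundEnergyAt_box (t : ℝ) {U : ℝ} (hU : 0 ≤ U) {ℓ : ℕ} (hℓ : 1 ≤ ℓ) {N : ℕ}
    (hN : N < 2 * (ℓ * ℓ)) :
    (ℓ : ℝ) ^ 2 * energyDensity2D t U ((N : ℝ) / (ℓ : ℝ) ^ 2) ≤
      groundEnergyAt (polyGraph (halfOpenBox 2 ℓ)) t U N + 48 * |t| * ℓ := by
  have hℓpos : (0 : ℝ) < ℓ := by exact_mod_cast hℓ
  have h1 := energyDensity2D_le_of_lt t hU hℓ hN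
  have h2 := groundEnergyAt_rect_le_polyGraph_halfOpenBox ℓ t U hN.le
  have h3 := mul_le_mul_of_nonneg_left h1 (sq_nonneg (ℓ : ℝ))
  rw [mul_add, mul_div_cancel₀ _ (by positivity), show (ℓ : ℝ) ^ 2 * (16 * |t| / ℓ) = 16 * |t| * ℓ by
    field_simp] at h3
  linarith

/-! ### The supporting line of the convex energy density -/

/-- **Supporting line**: for `U ≥ 0` and every density `0 < ρ < 2` there is a slope `s` with
`e(ρ) + s (x - ρ) ≤ e(x)` for all `x ∈ [0,2)` (convexity of `energyDensity2D t U` on `[0,2)`; `s` is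
the right derivative at `ρ`). [cite: Ruelle1969, §3.4 (convexity of the energy density)] -/
theorem exists_supporting_line_energyDensity2D (t : ℝ) {U : ℝ} (hU : 0 ≤ U) {ρ : ℝ} (hρ0 : 0 < ρ) (hρ2 : ρ < 2) :
    ∃ s : ℝ, ∀ x ∈ Set.Ico (0 : ℝ) 2, energyDensity2D t U ρ + s * (x - ρ) ≤ energyDensity2D t U x := by
  have hfc := convexOn_energyDensity2D t hU
  have hρint : ρ ∈ interior (Set.Ico (0 : ℝ) 2) := by rw [interior_Ico]; exact ⟨hρ0, hρ2⟩
  refine ⟨derivWithin (energyDensity2D t U) (Set.Ioi ρ) ρ, fun x hx => ?_⟩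
  rcases lt_trichotomy x ρ with hlt | rfl | hgt
  · have h1 := hfc.slope_le_leftDeriv_of_mem_interior hx hρint hlt
    have h2 := hfc.leftDeriv_le_rightDeriv_of_mem_interior hρint
    have h := h1.trans h2
    rw [slope_def_field, div_le_iff₀ (by linarith)] at h
    linarith
  · simp
  · have h := hfc.rightDeriv_le_slope_of_mem_interior hρint (hx : x ∈ Set.Ico (0 : ℝ) 2) hgt
    rw [slope_def_field, le_div_iff₀ (by linarith)] at h
    linarith

/-- **The supporting line stays below `U` at the filled band**: if `e(ρ) + s(x - ρ) ≤ e(x)` on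
`[0,2)` then `e(ρ) + s (2 - ρ) ≤ U` (evaluate at `x = (2ℓ² - 1)/ℓ² → 2`, where the box bound and
the one-hole energy `E_{[0,ℓ)²}(2ℓ² - 1) ≤ U ℓ²` give `e(x) ≤ U + 48|t|/ℓ`). [cite: Ruelle1969, §3.3] -/
theorem supporting_line_at_two_le (t : ℝ) {U : ℝ} (hU : 0 ≤ U) {ρ s : ℝ}
    (hs : ∀ x ∈ Set.Ico (0 : ℝ) 2, energyDensity2D t U ρ + s * (x - ρ) ≤ energyDensity2D t U x) :
    energyDensity2D t U ρ + s * (2 - ρ) ≤ U := by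
  -- along `x_ℓ = (2ℓ² - 1)/ℓ²`
  have hkey : ∀ ℓ : ℕ, 1 ≤ ℓ → energyDensity2D t U ρ + s * ((((2 * (ℓ * ℓ) - 1 : ℕ) : ℝ) / (ℓ : ℝ) ^ 2) - ρ) ≤
      U + 48 * |t| / ℓ := by
    intro ℓ hℓ
    have hℓpos : (0 : ℝ) < ℓ := by exact_mod_cast hℓ
    have hℓ2 : (0 : ℝ) < (ℓ : ℝ) ^ 2 := by positivity
    have hN : 2 * (ℓ * ℓ) - 1 < 2 * (ℓ * ℓ) := Nat.sub_lt (by positivity) one_pos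
    have hx : (((2 * (ℓ * ℓ) - 1 : ℕ) : ℝ) / (ℓ : ℝ) ^ 2) ∈ Set.Ico (0 : ℝ) 2 := by
      refine ⟨by positivity, ?_⟩
      rw [div_lt_iff₀ hℓ2]
      have : ((2 * (ℓ * ℓ) - 1 : ℕ) : ℝ) < ((2 * (ℓ * ℓ) : ℕ) : ℝ) := by exact_mod_cast hN
      push_cast at this; linarith
    have h1 := hs _ hx
    have h2 := sq_mul_energyDensity2D_le_groundEnergyAt_box t hU hℓ hN
    have hcard : Fintype.card (PolySite (halfOpenBox 2 ℓ)) = ℓ * ℓ := by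
      rw [card_polySite, card_halfOpenBox]; ring
    have h3 := groundEnergyAt_polyGraph_full_sub_one_le t hU (halfOpenBox 2 ℓ)
      ⟨0, mem_halfOpenBox.2 fun i => ⟨le_refl _, Int.natCast_pos.mpr hℓ⟩⟩
    rw [hcard] at h3
    push_cast at h3
    have h4 : (ℓ : ℝ) ^ 2 * energyDensity2D t U (((2 * (ℓ * ℓ) - 1 : ℕ) : ℝ) / (ℓ : ℝ) ^ 2) ≤
        (ℓ : ℝ) ^ 2 * (U + 48 * |t| / ℓ) := by
      rw [mul_add, show (ℓ : ℝ) ^ 2 * (48 * |t| / ℓ) = 48 * |t| * ℓ by field_simp]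
      nlinarith [h2, h3]
    have h5 := le_of_mul_le_mul_left h4 hℓ2
    linarith
  -- limits: `x_ℓ → 2`, `48|t|/ℓ → 0`
  have hx : Tendsto (fun ℓ : ℕ => (((2 * (ℓ * ℓ) - 1 : ℕ) : ℝ) / (ℓ : ℝ) ^ 2)) atTop (𝓝 2) := by
    have h : Tendsto (fun ℓ : ℕ => (2 : ℝ) - 1 / (ℓ : ℝ) ^ 2) atTop (𝓝 (2 - 0)) := by
      refine tendsto_const_nhds.sub ?_
      have := (tendsto_pow_atTop (α := ℝ) two_ne_zero).comp tendsto_natCast_atTop_atTop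
      simpa using this.const_div_atTop 1
    rw [sub_zero] at h
    refine h.congr' ?_
    filter_upwards [eventually_ge_atTop 1] with ℓ hℓ
    have hℓ2 : (0 : ℝ) < (ℓ : ℝ) ^ 2 := by positivity
    have hsub : ((2 * (ℓ * ℓ) - 1 : ℕ) : ℝ) = 2 * (ℓ : ℝ) ^ 2 - 1 := by
      rw [Nat.cast_sub (by nlinarith)]; push_cast; ring
    rw [hsub]; field_simp
  have herr : Tendsto (fun ℓ : ℕ => U + 48 * |t| / ℓ) atTop (𝓝 (U + 0)) :=
    tendsto_const_nhds.add (tendsto_const_nhds.div_atTop tendsto_natCast_atTop_atTop)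
  rw [add_zero] at herr
  have hlhs : Tendsto (fun ℓ : ℕ => energyDensity2D t U ρ + s * ((((2 * (ℓ * ℓ) - 1 : ℕ) : ℝ) / (ℓ : ℝ) ^ 2) - ρ))
      atTop (𝓝 (energyDensity2D t U ρ + s * (2 - ρ))) :=
    tendsto_const_nhds.add (tendsto_const_nhds.mul (hx.sub tendsto_const_nhds))
  exact le_of_tendsto_of_tendsto hlhs herr (by
    filter_upwards [eventually_ge_atTop 1] with ℓ hℓ using hkey ℓ hℓ)

end ThermodynamicLimit

end Literature.MathematicalPhysics.QuantumLattice

end
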